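import Mathlib
import HarnessLib
import Literature.NumberTheory.LFunctions.GaussianHeckeHybridMeanValue
import Summits.Parity.GeneralizedHardyLittlewood.Theorems.LiouvilleShiftedTablesEngineToPairsDefs
import Summits.Parity.GeneralizedHardyLittlewood.Theses.LiouvilleShiftedTables
import Summits.Parity.GeneralizedHardyLittlewood.Theorems.DilatedTableChowla.Negative.DilatedTableChowlaBlocks

/-!
# `stub_TII_of_X1`, part 1: class blocks and the fourth moment (line `Sketch`, crux `EngineToPairs`)

Type-II leaf of the correlation sieve, first file: for a modulus `q ≥ 1` with `(q, h) = 1` the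
rectangular bilinear form
`∑_{a ∈ (⌊A⌋, ⌊2A⌋]} ∑_{b ≤ x/A} α_a β_b · shiftWeight h q (ab)`
splits into CLASS BLOCKS `(u, v)`, `u, v < q`, `uv ≡ h (mod q)` (`rect_eq_sum_blocks`); on each block
two Cauchy–Schwarz inequalities (`fourthMoment_bilinear`) bound the block sum by
`‖α|_u‖ ‖β|_v‖ F(−h, x, A, q, u, v)^{1/4}` with `F` EXACTLY the block fourth moment of the crux
`DilatedTableChowla` (`DilatedTableChowlaBlocks.F`), and Cauchy–Schwarz over the blocks (the class maps
`u ↦ v`, `v ↦ u` are injective by coprimality) gives the per-modulus bound `abs_rect_le`: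
`|∑∑ α β shiftWeight| ≤ ‖α‖ ‖β‖ · max_{u,v} F(−h, x, A, q, u, v)^{1/4}`.
No new definitions: the blocks are written out (`rows`, `cols`, `L` of `DilatedTableChowlaBlocks`).
-/

noncomputable section

namespace Summit.Parity.GeneralizedHardyLittlewood.Theorems.EngineToPairs

namespace TIIOfX1

open Finset Real
open Summit.Parity.GeneralizedHardyLittlewood.Theorems.DilatedTableChowla.Negative

/-! ### Two Cauchy–Schwarz inequalities -/

-- adapted from Cruxes/EngineToPairs/SketchIdeator1.lean (`typeII_of_fourthMoment`)
/-- For any real kernel `K` and coefficients `α, β` on finite index sets,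
`(∑_a ∑_b α_a β_b K(a,b))⁴ ≤ (∑ α²)² (∑ β²)² ∑_{a,a'} (∑_b K(a,b)K(a',b))²`. [folklore] -/
theorem fourthMoment_bilinear {A Bs : Finset ℕ} (α β : ℕ → ℝ) (K : ℕ → ℕ → ℝ) :
    (∑ a ∈ A, ∑ b ∈ Bs, α a * β b * K a b) ^ 4 ≤
      (∑ a ∈ A, α a ^ 2) ^ 2 * (∑ b ∈ Bs, β b ^ 2) ^ 2 *
        ∑ a ∈ A, ∑ a' ∈ A, (∑ b ∈ Bs, K a b * K a' b) ^ 2 := by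
  -- first Cauchy–Schwarz, in `b`
  have h1 : (∑ a ∈ A, ∑ b ∈ Bs, α a * β b * K a b) ^ 2 ≤
      (∑ b ∈ Bs, β b ^ 2) * ∑ b ∈ Bs, (∑ a ∈ A, α a * K a b) ^ 2 := by
    have hswap : ∑ a ∈ A, ∑ b ∈ Bs, α a * β b * K a b =
        ∑ b ∈ Bs, β b * (∑ a ∈ A, α a * K a b) := by
      rw [Finset.sum_comm]
      refine Finset.sum_congr rfl fun b _ => ?_
      rw [Finset.mul_sum]
      refine Finset.sum_congr rfl fun a _ => ?_
      ring
    rw [hswap]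
    exact Finset.sum_mul_sq_le_sq_mul_sq Bs β (fun b => ∑ a ∈ A, α a * K a b)
  -- expand the square in `b` as a quadratic form in `(a, a')`
  have h2 : ∑ b ∈ Bs, (∑ a ∈ A, α a * K a b) ^ 2 =
      ∑ a ∈ A, ∑ a' ∈ A, α a * α a' * ∑ b ∈ Bs, K a b * K a' b := by
    have : ∀ b ∈ Bs, (∑ a ∈ A, α a * K a b) ^ 2 =
        ∑ a ∈ A, ∑ a' ∈ A, α a * α a' * (K a b * K a' b) := by
      intro b _
      rw [sq, Finset.sum_mul_sum]
      refine Finset.sum_congr rfl fun a _ => Finset.sum_congr rfl fun a' _ => ?_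
      ring
    rw [Finset.sum_congr rfl this, Finset.sum_comm]
    refine Finset.sum_congr rfl fun a _ => ?_
    rw [Finset.sum_comm]
    refine Finset.sum_congr rfl fun a' _ => ?_
    rw [Finset.mul_sum]
  -- second Cauchy–Schwarz, in `(a, a')`
  have h3 : (∑ a ∈ A, ∑ a' ∈ A, α a * α a' * ∑ b ∈ Bs, K a b * K a' b) ^ 2 ≤
      (∑ a ∈ A, ∑ a' ∈ A, (α a * α a') ^ 2) *
        ∑ a ∈ A, ∑ a' ∈ A, (∑ b ∈ Bs, K a b * K a' b) ^ 2 := by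
    have e1 : ∑ a ∈ A, ∑ a' ∈ A, α a * α a' * ∑ b ∈ Bs, K a b * K a' b =
        ∑ p ∈ A ×ˢ A, (α p.1 * α p.2) * ∑ b ∈ Bs, K p.1 b * K p.2 b := by
      rw [Finset.sum_product]
    have e2 : ∑ a ∈ A, ∑ a' ∈ A, (α a * α a') ^ 2 = ∑ p ∈ A ×ˢ A, (α p.1 * α p.2) ^ 2 := by
      rw [Finset.sum_product]
    have e3 : ∑ a ∈ A, ∑ a' ∈ A, (∑ b ∈ Bs, K a b * K a' b) ^ 2 =
        ∑ p ∈ A ×ˢ A, (∑ b ∈ Bs, K p.1 b * K p.2 b) ^ 2 := by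
      rw [Finset.sum_product]
    rw [e1, e2, e3]
    exact Finset.sum_mul_sq_le_sq_mul_sq (A ×ˢ A) (fun p => α p.1 * α p.2)
      (fun p => ∑ b ∈ Bs, K p.1 b * K p.2 b)
  have h4 : ∑ a ∈ A, ∑ a' ∈ A, (α a * α a') ^ 2 = (∑ a ∈ A, α a ^ 2) ^ 2 := by
    rw [sq (∑ a ∈ A, α a ^ 2), Finset.sum_mul_sum]
    refine Finset.sum_congr rfl fun a _ => Finset.sum_congr rfl fun a' _ => ?_
    ring
  calc (∑ a ∈ A, ∑ b ∈ Bs, α a * β b * K a b) ^ 4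
      = ((∑ a ∈ A, ∑ b ∈ Bs, α a * β b * K a b) ^ 2) ^ 2 := by ring
    _ ≤ ((∑ b ∈ Bs, β b ^ 2) * ∑ b ∈ Bs, (∑ a ∈ A, α a * K a b) ^ 2) ^ 2 :=
        pow_le_pow_left₀ (sq_nonneg _) h1 2
    _ = (∑ b ∈ Bs, β b ^ 2) ^ 2 *
          (∑ a ∈ A, ∑ a' ∈ A, α a * α a' * ∑ b ∈ Bs, K a b * K a' b) ^ 2 := by
        rw [mul_pow, h2]
    _ ≤ (∑ b ∈ Bs, β b ^ 2) ^ 2 * ((∑ a ∈ A, α a ^ 2) ^ 2 *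
          ∑ a ∈ A, ∑ a' ∈ A, (∑ b ∈ Bs, K a b * K a' b) ^ 2) := by
        rw [← h4]
        exact mul_le_mul_of_nonneg_left h3 (sq_nonneg _)
    _ = _ := by ring

/-- Fourth-root extraction: `t⁴ ≤ a² b² F` with `a, b, F ≥ 0` gives `|t| ≤ √a √b F^{1/4}`.
[folklore] -/
theorem abs_le_of_pow_four_le {t a b F : ℝ} (ha : 0 ≤ a) (hb : 0 ≤ b) (hF : 0 ≤ F)
    (h : t ^ 4 ≤ a ^ 2 * b ^ 2 * F) :
    |t| ≤ Real.sqrt a * Real.sqrt b * F ^ (1 / 4 : ℝ) := by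
  have hR : 0 ≤ Real.sqrt a * Real.sqrt b * F ^ (1 / 4 : ℝ) := by positivity
  rw [← pow_le_pow_iff_left₀ (abs_nonneg t) hR (by norm_num : (4 : ℕ) ≠ 0)]
  have h4a : Real.sqrt a ^ 4 = a ^ 2 := by
    rw [show (4 : ℕ) = 2 * 2 by norm_num, pow_mul, Real.sq_sqrt ha]
  have h4b : Real.sqrt b ^ 4 = b ^ 2 := by
    rw [show (4 : ℕ) = 2 * 2 by norm_num, pow_mul, Real.sq_sqrt hb]
  have h4F : (F ^ (1 / 4 : ℝ)) ^ 4 = F := by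
    rw [← Real.rpow_natCast, ← Real.rpow_mul hF]
    norm_num
  have ht : |t| ^ 4 = t ^ 4 := by
    rw [pow_abs]
    exact abs_of_nonneg (by positivity)
  rw [ht, mul_pow, mul_pow, h4a, h4b, h4F]
  exact h

/-! ### The rectangular form and its class blocks -/

/-- The crux entry at `c = −h` is `λ(ab − h)` (truncated subtraction on both sides). [folklore] -/
theorem L_mul_neg (h a b : ℕ) :
    L ((a : ℤ) * b + -(h : ℤ)) = (ArithmeticFunction.liouville (a * b - h) : ℝ) := by
  unfold L
  congr 2
  have : (a : ℤ) * b + -(h : ℤ) = ((a * b : ℕ) : ℤ) - h := by push_cast; ring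
  rw [this]
  omega

/-- On the block `a ≡ u`, `b ≡ v (mod q)` the weight `shiftWeight h q (ab)` is the constant
indicator `1[uv ≡ h]` times `λ(ab − h)`. [this line] -/
theorem shiftWeight_block {h q u v a b : ℕ} (ha : a ≡ u [MOD q]) (hb : b ≡ v [MOD q]) :
    shiftWeight h q (a * b) =
      if u * v ≡ h [MOD q] then L ((a : ℤ) * b + -(h : ℤ)) else 0 := by
  have hab : a * b ≡ u * v [MOD q] := ha.mul hb
  unfold shiftWeight
  rw [L_mul_neg]
  by_cases huv : u * v ≡ h [MOD q]
  · rw [if_pos (hab.trans huv), if_pos huv]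
  · rw [if_neg (fun h' => huv (hab.symm.trans h')), if_neg huv]

/-- Splitting a sum over `s` into residue classes mod `q ≥ 1`. [folklore] -/
theorem sum_range_sum_filter_modEq {q : ℕ} (hq : 1 ≤ q) (s : Finset ℕ) (f : ℕ → ℝ) :
    ∑ u ∈ range q, ∑ a ∈ s.filter (fun a : ℕ => a ≡ u [MOD q]), f a = ∑ a ∈ s, f a := by
  have hfib := Finset.sum_fiberwise_of_maps_to (s := s) (t := range q) (g := fun a : ℕ => a % q)
    (fun a _ => Finset.mem_range.2 (Nat.mod_lt a hq)) f
  rw [← hfib]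
  refine Finset.sum_congr rfl fun u hu => Finset.sum_congr ?_ fun _ _ => rfl
  ext a
  simp only [Finset.mem_filter, Nat.ModEq, Nat.mod_eq_of_lt (Finset.mem_range.1 hu)]

/-- **Class blocks.** For `q ≥ 1` the rectangular form
`∑_{a ∈ (⌊A⌋, ⌊2A⌋]} ∑_{b ≤ x/A} α_a β_b shiftWeight h q (ab)` is the sum over the admissible residue
pairs `(u, v)`, `u, v < q`, `uv ≡ h (mod q)`, of the block sums with the crux kernel `L(ab − h)` on
`rows A q u × cols x A q v`. [this line] -/
theorem rect_eq_sum_blocks (h : ℕ) {q : ℕ} (hq : 1 ≤ q) (x A : ℝ) (α β : ℕ → ℝ) :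
    ∑ a ∈ Ioc ⌊A⌋₊ ⌊2 * A⌋₊, ∑ b ∈ Icc 1 ⌊x / A⌋₊, α a * β b * shiftWeight h q (a * b) =
      ∑ p ∈ (range q ×ˢ range q).filter (fun p : ℕ × ℕ => p.1 * p.2 ≡ h [MOD q]),
        ∑ a ∈ rows A q p.1, ∑ b ∈ cols x A q p.2, α a * β b * L ((a : ℤ) * b + -(h : ℤ)) := by
  rw [Finset.sum_filter, Finset.sum_product,
    ← sum_range_sum_filter_modEq hq (Ioc ⌊A⌋₊ ⌊2 * A⌋₊)]
  refine Finset.sum_congr rfl fun u _ => ?_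
  have hcols : ∀ a ∈ (Ioc ⌊A⌋₊ ⌊2 * A⌋₊).filter (fun a : ℕ => a ≡ u [MOD q]),
      ∑ b ∈ Icc 1 ⌊x / A⌋₊, α a * β b * shiftWeight h q (a * b) =
        ∑ v ∈ range q, ∑ b ∈ cols x A q v, α a * β b * shiftWeight h q (a * b) := by
    intro a _
    unfold cols
    rw [sum_range_sum_filter_modEq hq]
  rw [Finset.sum_congr rfl hcols, Finset.sum_comm]
  refine Finset.sum_congr rfl fun v _ => ?_
  unfold rows
  split_ifs with huv
  · refine Finset.sum_congr rfl fun a ha => Finset.sum_congr rfl fun b hb => ?_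
    rw [shiftWeight_block (Finset.mem_filter.1 ha).2 (mem_cols.1 hb).2, if_pos huv]
  · refine Finset.sum_eq_zero fun a ha => Finset.sum_eq_zero fun b hb => ?_
    rw [shiftWeight_block (Finset.mem_filter.1 ha).2 (mem_cols.1 hb).2, if_neg huv, mul_zero]

/-- Coprimality makes the admissible pairs a partial bijection: `u` determines `v`. [folklore] -/
theorem pair_eq_of_fst_eq {q h : ℕ} (hqh : Nat.Coprime q h) {p p' : ℕ × ℕ}
    (hp : p ∈ (range q ×ˢ range q).filter (fun p : ℕ × ℕ => p.1 * p.2 ≡ h [MOD q]))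
    (hp' : p' ∈ (range q ×ˢ range q).filter (fun p : ℕ × ℕ => p.1 * p.2 ≡ h [MOD q]))
    (he : p.1 = p'.1) : p = p' := by
  simp only [Finset.mem_filter, Finset.mem_product, Finset.mem_range] at hp hp'
  obtain ⟨⟨-, h2⟩, h3⟩ := hp
  obtain ⟨⟨-, h2'⟩, h3'⟩ := hp'
  have hcop : Nat.Coprime (p.1 * p.2) q := by
    rw [Nat.Coprime, h3.gcd_eq]
    exact hqh.symm
  have hu : Nat.Coprime q p.1 := (Nat.Coprime.coprime_mul_right hcop).symm
  have hmod : p.1 * p.2 ≡ p.1 * p'.2 [MOD q] := by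
    have := h3'.symm
    rw [← he] at this
    exact h3.trans this
  have h22 : p.2 = p'.2 :=
    Nat.ModEq.eq_of_lt_of_lt (Nat.ModEq.cancel_left_of_coprime hu hmod) h2 h2'
  exact Prod.ext he h22

/-- … and `v` determines `u`. [folklore] -/
theorem pair_eq_of_snd_eq {q h : ℕ} (hqh : Nat.Coprime q h) {p p' : ℕ × ℕ}
    (hp : p ∈ (range q ×ˢ range q).filter (fun p : ℕ × ℕ => p.1 * p.2 ≡ h [MOD q]))
    (hp' : p' ∈ (range q ×ˢ range q).filter (fun p : ℕ × ℕ => p.1 * p.2 ≡ h [MOD q]))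
    (he : p.2 = p'.2) : p = p' := by
  simp only [Finset.mem_filter, Finset.mem_product, Finset.mem_range] at hp hp'
  obtain ⟨⟨h1, -⟩, h3⟩ := hp
  obtain ⟨⟨h1', -⟩, h3'⟩ := hp'
  have hcop : Nat.Coprime (p.1 * p.2) q := by
    rw [Nat.Coprime, h3.gcd_eq]
    exact hqh.symm
  have hv : Nat.Coprime q p.2 := (Nat.Coprime.coprime_mul_left hcop).symm
  have hmod : p.2 * p.1 ≡ p.2 * p'.1 [MOD q] := by
    have := h3'.symm
    rw [← he] at this
    rw [mul_comm p.2 p.1, mul_comm p.2 p'.1]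
    exact h3.trans this
  have h11 : p.1 = p'.1 :=
    Nat.ModEq.eq_of_lt_of_lt (Nat.ModEq.cancel_left_of_coprime hv hmod) h1 h1'
  exact Prod.ext h11 he

/-- Summing a nonnegative function of `u` over the admissible pairs is at most summing it over
all `u < q`. [folklore] -/
theorem sum_pairs_fst_le {q h : ℕ} (hqh : Nat.Coprime q h) (f : ℕ → ℝ) (hf : ∀ u, 0 ≤ f u) :
    ∑ p ∈ (range q ×ˢ range q).filter (fun p : ℕ × ℕ => p.1 * p.2 ≡ h [MOD q]), f p.1 ≤
      ∑ u ∈ range q, f u := by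
  rw [← Finset.sum_image (f := f) (g := Prod.fst)
    (s := (range q ×ˢ range q).filter (fun p : ℕ × ℕ => p.1 * p.2 ≡ h [MOD q]))
    (fun p hp p' hp' he => pair_eq_of_fst_eq hqh hp hp' he)]
  refine Finset.sum_le_sum_of_subset_of_nonneg (fun u hu => ?_) (fun u _ _ => hf u)
  obtain ⟨p, hp, rfl⟩ := Finset.mem_image.1 hu
  simp only [Finset.mem_filter, Finset.mem_product] at hp
  exact hp.1.1

/-- Same over `v`. [folklore] -/
theorem sum_pairs_snd_le {q h : ℕ} (hqh : Nat.Coprime q h) (f : ℕ → ℝ) (hf : ∀ v, 0 ≤ f v) :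
    ∑ p ∈ (range q ×ˢ range q).filter (fun p : ℕ × ℕ => p.1 * p.2 ≡ h [MOD q]), f p.2 ≤
      ∑ v ∈ range q, f v := by
  rw [← Finset.sum_image (f := f) (g := Prod.snd)
    (s := (range q ×ˢ range q).filter (fun p : ℕ × ℕ => p.1 * p.2 ≡ h [MOD q]))
    (fun p hp p' hp' he => pair_eq_of_snd_eq hqh hp hp' he)]
  refine Finset.sum_le_sum_of_subset_of_nonneg (fun v hv => ?_) (fun v _ _ => hf v)
  obtain ⟨p, hp, rfl⟩ := Finset.mem_image.1 hv
  simp only [Finset.mem_filter, Finset.mem_product] at hp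
  exact hp.1.2

/-! ### Per block and per modulus -/

/-- **Per block**: the block sum is at most `‖α|_u‖ ‖β|_v‖ F(−h, x, A, q, u, v)^{1/4}` with `F` the
block fourth moment of the crux `DilatedTableChowla`. [this line] -/
theorem abs_blockSum_le (h : ℕ) (x A : ℝ) (q u v : ℕ) (α β : ℕ → ℝ) :
    |∑ a ∈ rows A q u, ∑ b ∈ cols x A q v, α a * β b * L ((a : ℤ) * b + -(h : ℤ))| ≤
      Real.sqrt (∑ a ∈ rows A q u, α a ^ 2) * Real.sqrt (∑ b ∈ cols x A q v, β b ^ 2) *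
        F (-(h : ℤ)) x A q u v ^ (1 / 4 : ℝ) := by
  refine abs_le_of_pow_four_le (sum_nonneg fun _ _ => sq_nonneg _)
    (sum_nonneg fun _ _ => sq_nonneg _) (F_nonneg _ _ _ _ _ _) ?_
  have := fourthMoment_bilinear (A := rows A q u) (Bs := cols x A q v) α β
    (fun a b => L ((a : ℤ) * b + -(h : ℤ)))
  simpa only [F, S] using this

/-- **Per modulus**: for `q ≥ 1` coprime to `h` there is a block `(u, v)` (the one maximising `F`)
with `|∑∑ α_a β_b shiftWeight h q (ab)| ≤ ‖α‖ ‖β‖ F(−h, x, A, q, u, v)^{1/4}`. [this line] -/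
theorem abs_rect_le (h : ℕ) {q : ℕ} (hq : 1 ≤ q) (hqh : Nat.Coprime q h) (x A : ℝ)
    (α β : ℕ → ℝ) :
    ∃ u v : ℕ, |∑ a ∈ Ioc ⌊A⌋₊ ⌊2 * A⌋₊, ∑ b ∈ Icc 1 ⌊x / A⌋₊,
        α a * β b * shiftWeight h q (a * b)| ≤
      Real.sqrt (∑ a ∈ Ioc ⌊A⌋₊ ⌊2 * A⌋₊, α a ^ 2) * Real.sqrt (∑ b ∈ Icc 1 ⌊x / A⌋₊, β b ^ 2) *
        F (-(h : ℤ)) x A q u v ^ (1 / 4 : ℝ) := by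
  have hne : (range q ×ˢ range q).Nonempty := ⟨(0, 0), by simp; omega⟩
  obtain ⟨p₀, -, hmax⟩ :=
    Finset.exists_max_image (range q ×ˢ range q) (fun p : ℕ × ℕ => F (-(h : ℤ)) x A q p.1 p.2) hne
  refine ⟨p₀.1, p₀.2, ?_⟩
  set P : Finset (ℕ × ℕ) := (range q ×ˢ range q).filter (fun p : ℕ × ℕ => p.1 * p.2 ≡ h [MOD q])
    with hP
  set Fm : ℝ := F (-(h : ℤ)) x A q p₀.1 p₀.2 with hFm
  set αsq : ℕ → ℝ := fun u => ∑ a ∈ rows A q u, α a ^ 2 with hαsq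
  set βsq : ℕ → ℝ := fun v => ∑ b ∈ cols x A q v, β b ^ 2 with hβsq
  have hαnn : ∀ u, 0 ≤ αsq u := fun u => sum_nonneg fun _ _ => sq_nonneg _
  have hβnn : ∀ v, 0 ≤ βsq v := fun v => sum_nonneg fun _ _ => sq_nonneg _
  have hFm0 : 0 ≤ Fm := F_nonneg _ _ _ _ _ _
  have hα : ∑ p ∈ P, αsq p.1 ≤ ∑ a ∈ Ioc ⌊A⌋₊ ⌊2 * A⌋₊, α a ^ 2 := by
    refine (sum_pairs_fst_le hqh αsq hαnn).trans (le_of_eq ?_)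
    exact sum_range_sum_filter_modEq hq _ _
  have hβ : ∑ p ∈ P, βsq p.2 ≤ ∑ b ∈ Icc 1 ⌊x / A⌋₊, β b ^ 2 := by
    refine (sum_pairs_snd_le hqh βsq hβnn).trans (le_of_eq ?_)
    exact sum_range_sum_filter_modEq hq _ _
  calc |∑ a ∈ Ioc ⌊A⌋₊ ⌊2 * A⌋₊, ∑ b ∈ Icc 1 ⌊x / A⌋₊, α a * β b * shiftWeight h q (a * b)|
      = |∑ p ∈ P, ∑ a ∈ rows A q p.1, ∑ b ∈ cols x A q p.2,
          α a * β b * L ((a : ℤ) * b + -(h : ℤ))| := by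
        rw [rect_eq_sum_blocks h hq]
    _ ≤ ∑ p ∈ P, |∑ a ∈ rows A q p.1, ∑ b ∈ cols x A q p.2,
          α a * β b * L ((a : ℤ) * b + -(h : ℤ))| := abs_sum_le_sum_abs _ _
    _ ≤ ∑ p ∈ P, Real.sqrt (αsq p.1) * Real.sqrt (βsq p.2) * Fm ^ (1 / 4 : ℝ) := by
        refine sum_le_sum fun p hp => (abs_blockSum_le h x A q p.1 p.2 α β).trans ?_
        have hpF : F (-(h : ℤ)) x A q p.1 p.2 ≤ Fm := by
          refine hmax p ?_
          rw [hP, Finset.mem_filter] at hp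
          exact hp.1
        have : F (-(h : ℤ)) x A q p.1 p.2 ^ (1 / 4 : ℝ) ≤ Fm ^ (1 / 4 : ℝ) :=
          Real.rpow_le_rpow (F_nonneg _ _ _ _ _ _) hpF (by norm_num)
        exact mul_le_mul_of_nonneg_left this (by positivity)
    _ = Fm ^ (1 / 4 : ℝ) * ∑ p ∈ P, Real.sqrt (αsq p.1) * Real.sqrt (βsq p.2) := by
        rw [mul_sum]
        exact sum_congr rfl fun p _ => by ring
    _ ≤ Fm ^ (1 / 4 : ℝ) * (Real.sqrt (∑ p ∈ P, αsq p.1) * Real.sqrt (∑ p ∈ P, βsq p.2)) := by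
        gcongr
        exact Literature.NumberTheory.LFunctions.GaussianInt.sum_sqrt_mul_sqrt_le _
          (fun p => hαnn p.1) (fun p => hβnn p.2)
    _ ≤ Fm ^ (1 / 4 : ℝ) * (Real.sqrt (∑ a ∈ Ioc ⌊A⌋₊ ⌊2 * A⌋₊, α a ^ 2) *
          Real.sqrt (∑ b ∈ Icc 1 ⌊x / A⌋₊, β b ^ 2)) := by
        gcongr
    _ = _ := by ring

end TIIOfX1

/-- Anchor of part 1 of `stub_TII_of_X1`: the shifted class weight vanishes identically for the
degenerate modulus `q = 0` (`n ≡ h (mod 0)` forces `n = h`, and `λ(0) = 0`). [this line] -/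
theorem tiiOfX1_part1_anchor : ∀ h n : ℕ, shiftWeight h 0 n = 0 := by
  intro h n
  unfold shiftWeight
  split_ifs with hn
  · rw [Nat.modEq_zero_iff] at hn
    simp [hn]
  · rfl

end Summit.Parity.GeneralizedHardyLittlewood.Theorems.EngineToPairs

end
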